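import Literature.Geometry.DiscreteGeometry.KissingDelaunay
import Literature.Geometry.DiscreteGeometry.KissingNumberThreeProofs
import HarnessLib

/-!
# Saturation of twelve-point kissing configurations from the kissing number `k(3) = 12`
# (Hales 2012, proof of Theorem 2, first step) — proved WITHOUT `flyspeck_L12`

Topic `Literature/Geometry/DiscreteGeometry`; companion of `KissingSaturation.lean` and
`KissingDelaunay.lean` (Parts D–E), which derive the saturation of a twelve-point packing
`S ⊂ S²(2)` and its consequences for the Delaunay polyhedron `conv S` from the (unproved,
computer-assisted) Flyspeck inequality `flyspeck_L12`, in the sharp covering form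
`⟪x, s⟫ ≥ 2h₀`.  Hales's proof of the main estimate uses only the PLAIN kissing number problem:

* Hales, arXiv:1209.6043, proof of Theorem 2 (p. 6): "By the kissing number problem, `V′`, which
  has cardinality 12, is a saturated spherical network on `S²(2)`; that is, there is no room to add
  a further point on `S²(2)` that has distance at least `2` from all points of `V′`. By this
  saturation property, if `{u₁, u₂, u₃} ⊂ V′` is a Delaunay triangle, then the circumradius of the
  simplex `{0, u₁, u₂, u₃}` is less than `2`. Since `uᵢ ∈ S²(2)`, this corresponds to a Euclidean
  triangular circumradius less than `√3` for `{u₁, u₂, u₃}`."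

Since the kissing number `k(3) = 12` is PROVED in the tree (`musin2006_kissing_three_holds`,
`KissingNumberThreeProofs.lean`, Musin's Delsarte-type argument), these statements hold
unconditionally, and we record them here in exactly the strength the printed proof uses
(`η > 1`, circumradius `< 2`, facet circumradius `< √3`, diameter of a facet `< 2√3`), for any
twelve points of `S²(2)` at pairwise distance `≥ 2` and in particular for every `V ∈ 𝒱`
(`IsKissingConfig`):

* `exists_dist_lt_two_of_twelve`, `not_packing_thirteen_of_twelve` — saturation;
* `one_lt_of_supporting_of_twelve`, `exists_one_lt_inner_of_twelve` — every supporting half-space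
  `⟪n, ·⟫ ≤ η` (`‖n‖ = 1`) of `S` has `η > 1`; no closed half-space through `0` contains `S`;
* `norm_sub_smul_sq_lt_three_of_twelve`, `circumradius_lt_two_of_twelve`,
  `dist_lt_two_sqrt_three_of_twelve` — the points of `S` on a facet plane lie on a circle of radius
  `√(4 − η²) < √3` about `η n`, the simplex `{0} ∪ facet` has circumradius `2/η < 2`, and two points
  of a facet are `< 2√3` apart;
* `affineSpan_eq_top_of_twelve`, `zero_mem_interior_convexHull_of_twelve` — `S` spans `ℝ³`
  affinely and `0` is an interior point of `conv S` (so the facet cones at `0` tile space);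
* the specialisations `IsKissingConfig.*_sat` to Hales's class `𝒱`.

The proofs are those of the `L12` versions with `exists_two_mul_h0_le_inner_of_L12` replaced by
the thirteen-spheres contradiction.  Nothing here is a named fact.

## References

* T. C. Hales, *A proof of Fejes Tóth's conjecture on sphere packings with kissing number twelve*,
  arXiv:1209.6043 (2012), proof of Theorem 2, p. 6 (`Hales2012`).
* O. R. Musin, *The kissing problem in three dimensions*, Discrete Comput. Geom. 35 (2006)
  375–384 (`Musin2005`).
-/

noncomputable section

namespace Literature.Geometry.DiscreteGeometry

open Finset RealInnerProductSpace

variable {S : Set (EuclideanSpace ℝ (Fin 3))}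

/-! ### Saturation from the kissing number -/

/-- **"`V′` is a saturated spherical network on `S²(2)`" from `k(3) = 12`.**  For twelve points of
`S²(2)` at pairwise distance `≥ 2` and any `x ∈ S²(2)`, some point of the configuration is at
distance `< 2` from `x`: otherwise the thirteen points `S ∪ {x}`, halved, would be unit vectors at
pairwise distance `≥ 1`, against `musin2006_kissing_three_holds`.
[cite: Hales2012, proof of Theorem 2 (p. 6)] -/
theorem exists_dist_lt_two_of_twelve (h12 : S.ncard = 12) (hn : ∀ s ∈ S, ‖s‖ = 2)
    (hp : ∀ s ∈ S, ∀ t ∈ S, s ≠ t → 2 ≤ dist s t)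
    {x : EuclideanSpace ℝ (Fin 3)} (hx : ‖x‖ = 2) :
    ∃ s ∈ S, dist x s < 2 := by
  classical
  by_contra hcon
  push Not at hcon
  have hfin : S.Finite := Set.finite_of_ncard_ne_zero (by rw [h12]; norm_num)
  set F : Finset (EuclideanSpace ℝ (Fin 3)) := hfin.toFinset with hF
  have hFcard : F.card = 12 := by rw [hF, ← Set.ncard_eq_toFinset_card _ hfin]; exact h12
  have hmem : ∀ s, s ∈ F ↔ s ∈ S := fun s => by rw [hF, Set.Finite.mem_toFinset]
  have hxF : x ∉ F := fun h => by
    have := hcon x ((hmem x).1 h)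
    rw [dist_self] at this
    linarith
  -- the thirteen points, halved
  set G : Finset (EuclideanSpace ℝ (Fin 3)) := (insert x F).image (fun p => (2 : ℝ)⁻¹ • p) with hG
  have hinj : Function.Injective (fun p : EuclideanSpace ℝ (Fin 3) => (2 : ℝ)⁻¹ • p) := by
    intro p q hpq
    have := congrArg (fun z => (2 : ℝ) • z) hpq
    simpa [smul_smul] using this
  have hGcard : G.card = 13 := by
    rw [hG, Finset.card_image_of_injective _ hinj, Finset.card_insert_of_notMem hxF, hFcard]
  have hnorm2 : ∀ p ∈ insert x F, ‖p‖ = 2 := by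
    intro p hp'
    rcases Finset.mem_insert.1 hp' with rfl | hpF
    · exact hx
    · exact hn p ((hmem p).1 hpF)
  have hdist2 : ∀ p ∈ insert x F, ∀ q ∈ insert x F, p ≠ q → 2 ≤ dist p q := by
    intro p hp' q hq hpq
    rcases Finset.mem_insert.1 hp' with rfl | hpF
    · rcases Finset.mem_insert.1 hq with rfl | hqF
      · exact absurd rfl hpq
      · exact hcon q ((hmem q).1 hqF)
    · rcases Finset.mem_insert.1 hq with rfl | hqF
      · rw [dist_comm]; exact hcon p ((hmem p).1 hpF)
      · exact hp p ((hmem p).1 hpF) q ((hmem q).1 hqF) hpq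
  have hG1 : ∀ v ∈ G, ‖v‖ = 1 := by
    intro v hv
    obtain ⟨p, hp', rfl⟩ := Finset.mem_image.1 hv
    rw [norm_smul, norm_inv, Real.norm_two, hnorm2 p hp']
    norm_num
  have hGd : ∀ v ∈ G, ∀ w ∈ G, v ≠ w → 1 ≤ dist v w := by
    intro v hv w hw hvw
    obtain ⟨p, hp', rfl⟩ := Finset.mem_image.1 hv
    obtain ⟨q, hq, rfl⟩ := Finset.mem_image.1 hw
    have hpq : p ≠ q := fun h => hvw (by rw [h])
    have h2 := hdist2 p hp' q hq hpq
    rw [dist_smul₀, norm_inv, Real.norm_two]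
    linarith
  have := musin2006_kissing_three_holds G hG1 hGd
  omega

/-- **No thirteenth kissing ball**: `S ∪ {x}` is not a packing for any new `x ∈ S²(2)`
(unconditional form of `not_packing_thirteen_of_L12`). [cite: Hales2012, proof of Theorem 2 (p. 6)] -/
theorem not_packing_thirteen_of_twelve (h12 : S.ncard = 12) (hn : ∀ s ∈ S, ‖s‖ = 2)
    (hp : ∀ s ∈ S, ∀ t ∈ S, s ≠ t → 2 ≤ dist s t)
    {x : EuclideanSpace ℝ (Fin 3)} (hx : ‖x‖ = 2) :
    ¬ ∀ s ∈ S, 2 ≤ dist x s := by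
  intro h
  obtain ⟨s, hs, hlt⟩ := exists_dist_lt_two_of_twelve h12 hn hp hx
  exact absurd (h s hs) (not_le.2 hlt)

/-! ### Supporting planes are at height `> 1` -/

/-- **Supporting half-spaces of a twelve-point packing on `S²(2)` have height `> 1`** ("Hales uses
the weaker consequence of plain saturation, `η > 1`", cf. `h0_le_of_forall_inner_le`): if `‖n‖ = 1`
and `⟪n, s⟫ ≤ η` on `S`, then `1 < η`, since some `s ∈ S` is at distance `< 2` from `2n ∈ S²(2)`,
i.e. has `⟪n, s⟫ > 1`. [cite: Hales2012, proof of Theorem 2 (p. 6)] -/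
theorem one_lt_of_supporting_of_twelve (h12 : S.ncard = 12) (hn : ∀ s ∈ S, ‖s‖ = 2)
    (hp : ∀ s ∈ S, ∀ t ∈ S, s ≠ t → 2 ≤ dist s t)
    {n : EuclideanSpace ℝ (Fin 3)} (hn1 : ‖n‖ = 1) {η : ℝ} (h : ∀ s ∈ S, ⟪n, s⟫ ≤ η) :
    1 < η := by
  have hx : ‖(2 : ℝ) • n‖ = 2 := by rw [norm_smul, hn1, Real.norm_two, mul_one]
  obtain ⟨s, hs, h2⟩ := exists_dist_lt_two_of_twelve h12 hn hp hx
  have hsq : dist ((2 : ℝ) • n) s ^ 2 < 2 ^ 2 := by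
    have h0 : 0 ≤ dist ((2 : ℝ) • n) s := dist_nonneg
    nlinarith
  rw [dist_sq_eq_of_norm_eq_two hx (hn s hs), real_inner_smul_left] at hsq
  linarith [h s hs]

/-- Hence **`S` lies in no closed half-space through the origin**: for every unit vector `n` some
`s ∈ S` has `⟪n, s⟫ > 1`. [cite: Hales2012, proof of Theorem 2 (p. 6)] -/
theorem exists_one_lt_inner_of_twelve (h12 : S.ncard = 12) (hn : ∀ s ∈ S, ‖s‖ = 2)
    (hp : ∀ s ∈ S, ∀ t ∈ S, s ≠ t → 2 ≤ dist s t)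
    {n : EuclideanSpace ℝ (Fin 3)} (hn1 : ‖n‖ = 1) : ∃ s ∈ S, 1 < ⟪n, s⟫ := by
  by_contra hcon
  push Not at hcon
  have := one_lt_of_supporting_of_twelve h12 hn hp hn1 hcon
  exact lt_irrefl _ this

/-! ### Facets: circumradius `< √3`, simplex circumradius `< 2`, diameter `< 2√3` -/

/-- **"A Euclidean triangular circumradius less than `√3`"**: if the plane `⟪n, ·⟫ = η`
(`‖n‖ = 1`) supports `S`, every `s ∈ S` on it has `‖s − η n‖² = 4 − η² < 3` — the points of `S`
on a facet plane of `conv S` lie on a circle of radius `< √3` about `η n`.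
[cite: Hales2012, proof of Theorem 2 (p. 6)] -/
theorem norm_sub_smul_sq_lt_three_of_twelve (h12 : S.ncard = 12) (hn : ∀ s ∈ S, ‖s‖ = 2)
    (hp : ∀ s ∈ S, ∀ t ∈ S, s ≠ t → 2 ≤ dist s t)
    {n : EuclideanSpace ℝ (Fin 3)} (hn1 : ‖n‖ = 1) {η : ℝ} (h : ∀ s ∈ S, ⟪n, s⟫ ≤ η)
    {s : EuclideanSpace ℝ (Fin 3)} (hs : s ∈ S) (hse : ⟪n, s⟫ = η) :
    ‖s - η • n‖ ^ 2 < 3 := by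
  rw [norm_sub_smul_sq_of_inner_eq (hn s hs) hn1 hse]
  have h1 : 1 < η := one_lt_of_supporting_of_twelve h12 hn hp hn1 h
  nlinarith

/-- The printed form `‖s − η n‖ < √3`. [cite: Hales2012, proof of Theorem 2 (p. 6)] -/
theorem norm_sub_smul_lt_sqrt_three_of_twelve (h12 : S.ncard = 12) (hn : ∀ s ∈ S, ‖s‖ = 2)
    (hp : ∀ s ∈ S, ∀ t ∈ S, s ≠ t → 2 ≤ dist s t)
    {n : EuclideanSpace ℝ (Fin 3)} (hn1 : ‖n‖ = 1) {η : ℝ} (h : ∀ s ∈ S, ⟪n, s⟫ ≤ η)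
    {s : EuclideanSpace ℝ (Fin 3)} (hs : s ∈ S) (hse : ⟪n, s⟫ = η) :
    ‖s - η • n‖ < Real.sqrt 3 := by
  rw [Real.lt_sqrt (norm_nonneg _)]
  exact norm_sub_smul_sq_lt_three_of_twelve h12 hn hp hn1 h hs hse

/-- **"The circumradius of the simplex `{0, u₁, u₂, u₃}` is less than `2`"**: with `c = (2/η) n`,
every `s ∈ S` on the supporting plane `⟪n, ·⟫ = η` has `dist c s = ‖c‖ = 2/η`, and `2/η < 2`.
[cite: Hales2012, proof of Theorem 2 (p. 6)] -/
theorem circumradius_lt_two_of_twelve (h12 : S.ncard = 12) (hn : ∀ s ∈ S, ‖s‖ = 2)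
    (hp : ∀ s ∈ S, ∀ t ∈ S, s ≠ t → 2 ≤ dist s t)
    {n : EuclideanSpace ℝ (Fin 3)} (hn1 : ‖n‖ = 1) {η : ℝ} (h : ∀ s ∈ S, ⟪n, s⟫ ≤ η) :
    ‖(2 / η) • n‖ = 2 / η ∧ (∀ s ∈ S, ⟪n, s⟫ = η → dist ((2 / η) • n) s = 2 / η) ∧ 2 / η < 2 := by
  have h1 : 1 < η := one_lt_of_supporting_of_twelve h12 hn hp hn1 h
  have hηpos : 0 < η := by linarith
  have hc : ‖(2 / η) • n‖ = 2 / η := by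
    rw [norm_smul, hn1, mul_one, Real.norm_of_nonneg (by positivity)]
  refine ⟨hc, fun s hs hse => ?_, ?_⟩
  · have h2 : dist ((2 / η) • n) s ^ 2 = (2 / η) ^ 2 := by
      rw [dist_eq_norm, norm_sub_sq_real, hc, hn s hs, real_inner_smul_left, hse]
      field_simp
      ring
    have h3 : 0 ≤ dist ((2 / η) • n) s := dist_nonneg
    have h4 : (0 : ℝ) ≤ 2 / η := by positivity
    nlinarith [h2]
  · rw [div_lt_iff₀ hηpos]
    linarith

/-- **Diameter of a facet**: two points of `S` on a common supporting plane are at distance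
`< 2√3` ("Edges of Delaunay triangles … The upper bound on these edges will be determined by the
circumradius constraint"). [cite: Hales2012, proof of Theorem 2 (p. 6)] -/
theorem dist_lt_two_sqrt_three_of_twelve (h12 : S.ncard = 12) (hn : ∀ s ∈ S, ‖s‖ = 2)
    (hp : ∀ s ∈ S, ∀ t ∈ S, s ≠ t → 2 ≤ dist s t)
    {n : EuclideanSpace ℝ (Fin 3)} (hn1 : ‖n‖ = 1) {η : ℝ} (h : ∀ s ∈ S, ⟪n, s⟫ ≤ η)
    {s t : EuclideanSpace ℝ (Fin 3)} (hs : s ∈ S) (hse : ⟪n, s⟫ = η) (ht : t ∈ S)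
    (hte : ⟪n, t⟫ = η) : dist s t < 2 * Real.sqrt 3 := by
  have h1 := norm_sub_smul_lt_sqrt_three_of_twelve h12 hn hp hn1 h hs hse
  have h2 := norm_sub_smul_lt_sqrt_three_of_twelve h12 hn hp hn1 h ht hte
  calc dist s t = ‖(s - η • n) - (t - η • n)‖ := by rw [dist_eq_norm, sub_sub_sub_cancel_right]
    _ ≤ ‖s - η • n‖ + ‖t - η • n‖ := norm_sub_le _ _
    _ < 2 * Real.sqrt 3 := by linarith

/-! ### The origin is an interior point of the convex hull -/

/-- `S` is not contained in a plane: its affine span is all of `ℝ³` (unconditional form of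
`affineSpan_eq_top_of_L12`). [cite: Hales2012, proof of Theorem 2 (p. 6)] -/
theorem affineSpan_eq_top_of_twelve (h12 : S.ncard = 12) (hn : ∀ s ∈ S, ‖s‖ = 2)
    (hp : ∀ s ∈ S, ∀ t ∈ S, s ≠ t → 2 ≤ dist s t) : affineSpan ℝ S = ⊤ := by
  have hne : S.Nonempty := Set.nonempty_of_ncard_ne_zero (by rw [h12]; norm_num)
  by_contra htop
  have hdir : (affineSpan ℝ S).direction ≠ ⊤ := by
    rwa [Ne, AffineSubspace.direction_eq_top_iff_of_nonempty
      ((affineSpan_nonempty (k := ℝ)).2 hne)]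
  rw [direction_affineSpan] at hdir
  have horth : (vectorSpan ℝ S)ᗮ ≠ ⊥ := by
    rwa [Ne, Submodule.orthogonal_eq_bot_iff]
  obtain ⟨m, hm, hm0⟩ := (Submodule.ne_bot_iff _).1 horth
  obtain ⟨s₀, hs₀⟩ := hne
  have hconst : ∀ s ∈ S, ⟪m, s⟫ = ⟪m, s₀⟫ := by
    intro s hs
    have h1 : s -ᵥ s₀ ∈ vectorSpan ℝ S := vsub_mem_vectorSpan ℝ hs hs₀
    have h2 : ⟪s -ᵥ s₀, m⟫ = 0 := Submodule.inner_right_of_mem_orthogonal h1 hm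
    rw [vsub_eq_sub, inner_sub_left, sub_eq_zero] at h2
    rw [real_inner_comm, h2, real_inner_comm]
  have hmpos : 0 < ‖m‖ := norm_pos_iff.2 hm0
  set n : EuclideanSpace ℝ (Fin 3) := ‖m‖⁻¹ • m with hn'
  have hn1 : ‖n‖ = 1 := by
    rw [hn', norm_smul, norm_inv, norm_norm, inv_mul_cancel₀ hmpos.ne']
  have hn1' : ‖-n‖ = 1 := by rw [norm_neg, hn1]
  have h1 := one_lt_of_supporting_of_twelve h12 hn hp hn1 (η := ‖m‖⁻¹ * ⟪m, s₀⟫)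
    (fun s hs => by rw [hn', real_inner_smul_left, hconst s hs])
  have h2 := one_lt_of_supporting_of_twelve h12 hn hp hn1' (η := -(‖m‖⁻¹ * ⟪m, s₀⟫))
    (fun s hs => by rw [inner_neg_left, hn', real_inner_smul_left, hconst s hs])
  linarith

/-- **The origin is an interior point of `conv S`** for a twelve-point packing `S ⊂ S²(2)`
(unconditional form of `zero_mem_interior_convexHull_of_L12`): otherwise a plane through `0`
would support `conv S`, contradicting `exists_one_lt_inner_of_twelve`.
[cite: Hales2012, proof of Theorem 2 (p. 6)] -/
theorem zero_mem_interior_convexHull_of_twelve (h12 : S.ncard = 12) (hn : ∀ s ∈ S, ‖s‖ = 2)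
    (hp : ∀ s ∈ S, ∀ t ∈ S, s ≠ t → 2 ≤ dist s t) :
    (0 : EuclideanSpace ℝ (Fin 3)) ∈ interior (convexHull ℝ S) := by
  by_contra h0
  have hC : Convex ℝ (convexHull ℝ S) := convex_convexHull ℝ S
  have hint : (interior (convexHull ℝ S)).Nonempty :=
    interior_convexHull_nonempty_iff_affineSpan_eq_top.2 (affineSpan_eq_top_of_twelve h12 hn hp)
  obtain ⟨f, hf⟩ := geometric_hahn_banach_open_point hC.interior isOpen_interior h0
  rw [map_zero] at hf
  have hle : ∀ s ∈ S, f s ≤ 0 := by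
    intro s hs
    have hs' : s ∈ closure (interior (convexHull ℝ S)) := by
      rw [hC.closure_interior_eq_closure_of_nonempty_interior hint]
      exact subset_closure (subset_convexHull ℝ S hs)
    exact closure_minimal (fun a ha => (hf a ha).le) (isClosed_le f.continuous continuous_const) hs'
  set m : EuclideanSpace ℝ (Fin 3) := (InnerProductSpace.toDual ℝ _).symm f with hm
  have hfm : ∀ a, f a = ⟪m, a⟫ := fun a => by rw [hm, InnerProductSpace.toDual_symm_apply]
  obtain ⟨a, ha⟩ := hint
  have hm0 : m ≠ 0 := by
    intro hm0
    have := hf a ha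
    rw [hfm, hm0, inner_zero_left] at this
    exact lt_irrefl _ this
  have hmpos : 0 < ‖m‖ := norm_pos_iff.2 hm0
  have hn1 : ‖‖m‖⁻¹ • m‖ = 1 := by
    rw [norm_smul, norm_inv, norm_norm, inv_mul_cancel₀ hmpos.ne']
  have h1 := one_lt_of_supporting_of_twelve h12 hn hp hn1 (η := 0) (fun s hs => by
    rw [real_inner_smul_left, ← hfm]
    exact mul_nonpos_of_nonneg_of_nonpos (inv_nonneg.2 (norm_nonneg _)) (hle s hs))
  linarith

/-! ### Specialisation to Hales's class `𝒱` (`IsKissingConfig`) -/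

/-- **Every `V ∈ 𝒱` is a saturated spherical network on `S²(2)`** (unconditionally).
[cite: Hales2012, proof of Theorem 2 (p. 6)] -/
theorem IsKissingConfig.exists_dist_lt_two_sat (hS : IsKissingConfig S)
    {x : EuclideanSpace ℝ (Fin 3)} (hx : ‖x‖ = 2) : ∃ s ∈ S, dist x s < 2 :=
  exists_dist_lt_two_of_twelve hS.ncard_eq (fun _ hs => hS.norm_eq hs)
    (fun _ hs _ ht hst => hS.two_le_dist hs ht hst) hx

/-- For `V ∈ 𝒱`, supporting half-spaces `⟪n, ·⟫ ≤ η` (`‖n‖ = 1`) have `η > 1` (unconditionally).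
[cite: Hales2012, proof of Theorem 2 (p. 6)] -/
theorem IsKissingConfig.one_lt_of_supporting (hS : IsKissingConfig S)
    {n : EuclideanSpace ℝ (Fin 3)} (hn1 : ‖n‖ = 1) {η : ℝ} (h : ∀ s ∈ S, ⟪n, s⟫ ≤ η) : 1 < η :=
  one_lt_of_supporting_of_twelve hS.ncard_eq (fun _ hs => hS.norm_eq hs)
    (fun _ hs _ ht hst => hS.two_le_dist hs ht hst) hn1 h

/-- For `V ∈ 𝒱` and every unit vector `n`, some `s ∈ V` has `⟪n, s⟫ > 1` (unconditionally).
[cite: Hales2012, proof of Theorem 2 (p. 6)] -/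
theorem IsKissingConfig.exists_one_lt_inner (hS : IsKissingConfig S)
    {n : EuclideanSpace ℝ (Fin 3)} (hn1 : ‖n‖ = 1) : ∃ s ∈ S, 1 < ⟪n, s⟫ :=
  exists_one_lt_inner_of_twelve hS.ncard_eq (fun _ hs => hS.norm_eq hs)
    (fun _ hs _ ht hst => hS.two_le_dist hs ht hst) hn1

/-- For `V ∈ 𝒱`, the points of `V` on a supporting plane lie on a circle of radius `< √3`
("Euclidean triangular circumradius less than `√3`"), unconditionally.
[cite: Hales2012, proof of Theorem 2 (p. 6)] -/
theorem IsKissingConfig.norm_sub_smul_lt_sqrt_three_sat (hS : IsKissingConfig S)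
    {n : EuclideanSpace ℝ (Fin 3)} (hn1 : ‖n‖ = 1) {η : ℝ} (h : ∀ s ∈ S, ⟪n, s⟫ ≤ η)
    {s : EuclideanSpace ℝ (Fin 3)} (hs : s ∈ S) (hse : ⟪n, s⟫ = η) :
    ‖s - η • n‖ < Real.sqrt 3 :=
  norm_sub_smul_lt_sqrt_three_of_twelve hS.ncard_eq (fun _ hs => hS.norm_eq hs)
    (fun _ hs _ ht hst => hS.two_le_dist hs ht hst) hn1 h hs hse

/-- For `V ∈ 𝒱`, the simplex `{0} ∪ (facet)` on a supporting plane `⟪n, ·⟫ = η` has circumcentre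
`(2/η) n` and circumradius `2/η < 2`, unconditionally. [cite: Hales2012, proof of Theorem 2 (p. 6)] -/
theorem IsKissingConfig.circumradius_lt_two (hS : IsKissingConfig S)
    {n : EuclideanSpace ℝ (Fin 3)} (hn1 : ‖n‖ = 1) {η : ℝ} (h : ∀ s ∈ S, ⟪n, s⟫ ≤ η) :
    ‖(2 / η) • n‖ = 2 / η ∧ (∀ s ∈ S, ⟪n, s⟫ = η → dist ((2 / η) • n) s = 2 / η) ∧ 2 / η < 2 :=
  circumradius_lt_two_of_twelve hS.ncard_eq (fun _ hs => hS.norm_eq hs)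
    (fun _ hs _ ht hst => hS.two_le_dist hs ht hst) hn1 h

/-- For `V ∈ 𝒱`, two points of `V` on a common supporting plane of `conv V` are at distance
`< 2√3`, unconditionally. [cite: Hales2012, proof of Theorem 2 (p. 6)] -/
theorem IsKissingConfig.dist_lt_two_sqrt_three (hS : IsKissingConfig S)
    {n : EuclideanSpace ℝ (Fin 3)} (hn1 : ‖n‖ = 1) {η : ℝ} (h : ∀ s ∈ S, ⟪n, s⟫ ≤ η)
    {s t : EuclideanSpace ℝ (Fin 3)} (hs : s ∈ S) (hse : ⟪n, s⟫ = η) (ht : t ∈ S)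
    (hte : ⟪n, t⟫ = η) : dist s t < 2 * Real.sqrt 3 :=
  dist_lt_two_sqrt_three_of_twelve hS.ncard_eq (fun _ hs => hS.norm_eq hs)
    (fun _ hs _ ht hst => hS.two_le_dist hs ht hst) hn1 h hs hse ht hte

/-- For `V ∈ 𝒱`, `V` spans `ℝ³` affinely, unconditionally. [cite: Hales2012, proof of Theorem 2 (p. 6)] -/
theorem IsKissingConfig.affineSpan_eq_top (hS : IsKissingConfig S) : affineSpan ℝ S = ⊤ :=
  affineSpan_eq_top_of_twelve hS.ncard_eq (fun _ hs => hS.norm_eq hs)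
    (fun _ hs _ ht hst => hS.two_le_dist hs ht hst)

/-- For `V ∈ 𝒱`, `0` is an interior point of `conv V`, unconditionally (so the cones over the
facets of the Delaunay polyhedron partition space and their solid angles add up to `4π`).
[cite: Hales2012, proof of Theorem 2 (p. 6)] -/
theorem IsKissingConfig.zero_mem_interior_convexHull_sat (hS : IsKissingConfig S) :
    (0 : EuclideanSpace ℝ (Fin 3)) ∈ interior (convexHull ℝ S) :=
  zero_mem_interior_convexHull_of_twelve hS.ncard_eq (fun _ hs => hS.norm_eq hs)
    (fun _ hs _ ht hst => hS.two_le_dist hs ht hst)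

end Literature.Geometry.DiscreteGeometry

end
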